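import Summits.NavierStokesRegularity.NavierStokesRegularity.Theorems.SoloSalvageLucardoOlivaes2026GIBlob
import HarnessLib

/-!
# C137 `LucardoOlivaes2026` (cell `ns-claims`, D-0090) — kernel NON-VACUITY GUARD for the token of record,
# part 3/3: `step3GI_Datum_holds : Step3GI_Datum`

Claim C137: skeleton `Literature.Claims.NS.LucardoOlivaes2026` (typist-10 g4; rev 4 p513667). ADJUDICATED #120
(chair, 2026-08-27T08:29:10Z) located the first failing step at `Step6GI_StretchLower` (§4.1 display (6), p.2
l.44–54, read over the printed geometric class of §3 p.2 l.12–26 with the INTEGRAL alignment `0 < ∫ ωᵀSω`),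
class unfilled gap, and recorded that the class `Step3GI_Datum` was «inhabited on paper only … OPEN in the tree
= the non-vacuity guard the VERDICT presupposes» (REF F6). The three files
`SoloSalvageLucardoOlivaes2026GICavity` → `SoloSalvageLucardoOlivaes2026GIBlob` → `SoloSalvageLucardoOlivaes2026GI`
construct an explicit member and prove `step3GI_Datum_holds : Step3GI_Datum` (file 3), which is at the same time
the D-0026 discharge of that named statement (chair RULINGS 2026-08-27T08:48Z (2): second refuter
`ns-claims-refuter-3` g3 builds, salvage seat `ns-claims-salvage-p4` g3 files unchanged, referee
`ns-claims-ref-1` g4 reads back). Source: J. R. Lucardo Olivaes, Zenodo 10.5281/zenodo.21815761 (2026), 3 pp.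

THE DATUM (parts 1–2 supply the cavity `C`, the ring `w`, the blob `F a = C + a • w` and `aW`). The cavity equals,
on the unit ball, the shifted expansive strain `(y₀, y₁, −2(y₂+2))`, whose stagnation point lies two units BELOW
the blob centre, so its axial velocity points DOWN (towards the collision plane) throughout the blob; the ring
enters with the NEGATIVE amplitude `aW`, so its own axial velocity `2·aW·G ≤ 0` points down as well, while the
stretching integral only sees `aW²`. Put the blob at height 3 and add its mirror image:
`U x = F aW (x + d) + R (F aW (R x + d))`, `d = (0,0,−3)`, `R = mirrorZ` (`Fu`, `Fl`, `U`). Proved here: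
* `isOuroDatum_U` — `C^∞`; divergence free (trace additivity, translation `fderiv_comp_add_right`, reflection
  `divergence_conj_linearIsometryEquiv`); every derivative in `L²` (compact support, `HasRapidSpatialDecay`);
  `curl U` compactly supported and `≠ 0` (at `x₀ − d` it equals `aW • curl w x₀ ≠ 0`);
* `isOuroGeometry_U` — (1) `U (R x) = R (U x)`; (2) no swirl; (3) `curl U = 0` on the plane `x₂ = 0` (`U ≡ 0` on
  the slab `|x₂| < 3/2`); (4) «approaching»: if `curl U x ≠ 0` and `x₂ > 0` then `y = x + d` lies in the closed
  ball of radius `√2` and off its two axis points (closure argument `curl_F_axis_boundary`), so on the axis at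
  that height `U₂ = −2 h(ζ²)(ζ+2) + 2 aW G(ζ²) < 0` with `ζ = x₂ − 3`, `ζ² < 2` (`U_axis_two_neg`); the case
  `x₂ < 0` follows by the mirror symmetry (`curl_U_mirrorZ`), and `x₂ = 0` is excluded by (3);
* `stretchI_U : stretchI U = 2 · stretchI (F aW)` — the two blobs never see each other (pointwise splitting
  `sI_U`), translation invariance of Lebesgue measure (`integral_add_right_eq_self`) and the measure-preserving
  mirror — hence `isAlignedDatumI_U : 0 < stretchI U`;
* `step3GI_Datum_holds : Step3GI_Datum := ⟨U, isOuroDatum_U, isOuroGeometry_U, isAlignedDatumI_U⟩`.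
All velocities are compactly supported (no Biot–Savart law is needed). Nothing here concerns the Navier–Stokes
evolution of `U`: the located step `Step6GI_StretchLower` asks for PERSISTENCE of a stretching lower bound along
the solution, which this file does not touch; no verdict, class or total of the record changes.

WHAT THIS IS NOT: not a claim about NS regularity or blow-up; not a claim about any author beyond the typed
locator.
-/

-- The summit's canonical theorem namespace repeats the summit name (single-conjunct summit).
set_option linter.dupNamespace false

noncomputable section

open Set MeasureTheory Filter Topology Function Metric
open scoped RealInnerProductSpace ContDiff

namespace Summit.NavierStokesRegularity.NavierStokesRegularity.Theorems.LucardoOlivaes2026GI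

open Literature.Analysis.FluidPDE
open Literature.Claims.NS.LucardoOlivaes2026
open Literature.Claims.NS.Chae2007 (IsDatum)
open Summit.NavierStokesRegularity.NavierStokesRegularity.Theorems.Bledsoe2026 (w x₀ w_contDiff
  w_differentiable w_hasCompactSupport divergence_w curl_w_x₀_ne_zero curl_w_eq_zero w_eq_zero
  fderiv_w_eq_zero w_apply_zero w_apply_one w_apply_two curl_w_apply_two G G_eq_zero Dlin Dlin_apply
  curl_Dlin inner_Dlin_of_horizontal contDiff_coord hasFDerivAt_radial)

/-! ### The datum `U`: the blob moved up to height 3, plus its mirror image -/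

/-- Translation vector `d = (0,0,−3)`: the upper blob sits at `x + d = y`, i.e. is centred at `(0,0,3)`. -/
def dvec : E3 := EuclideanSpace.single 2 (-3)

/-- kit lemma (plumbing) [folklore] -/ theorem add_dvec_apply_two (x : E3) : (x + dvec) 2 = x 2 - 3 := by
  simp [dvec]; ring

/-- kit lemma (plumbing) [folklore] -/ theorem normsq_add_dvec_ge (x : E3) : (x 2 - 3) ^ 2 ≤ ‖x + dvec‖ ^ 2 := by
  have h := sq_apply_two_le_normsq (x + dvec)
  rwa [add_dvec_apply_two] at h

/-- kit lemma (plumbing) [folklore] -/ theorem norm_dvec : ‖dvec‖ = 3 := by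
  have h : ‖dvec‖ ^ 2 = 9 := by rw [normsq_eq]; simp [dvec]; norm_num
  nlinarith [norm_nonneg dvec]

/-- The upper blob in the laboratory frame. -/
def Fu (x : E3) : E3 := F aW (x + dvec)

/-- The lower blob: the mirror image of the upper one. -/
def Fl (x : E3) : E3 := mirrorZ (Fu (mirrorZ x))

/-- **The datum.** -/
def U (x : E3) : E3 := Fu x + Fl x

/-- kit lemma (plumbing) [folklore] -/ theorem Fu_contDiff : ContDiff ℝ ∞ Fu := (F_contDiff aW).comp (contDiff_id.add contDiff_const)

/-- kit lemma (plumbing) [folklore] -/ theorem Fl_contDiff : ContDiff ℝ ∞ Fl :=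
  show ContDiff ℝ ∞ (fun x => Ri (Fu (Ri x))) from Ri.contDiff.comp (Fu_contDiff.comp Ri.contDiff)

/-- kit lemma (plumbing) [folklore] -/ theorem U_contDiff : ContDiff ℝ ∞ U := Fu_contDiff.add Fl_contDiff

/-- kit lemma (plumbing) [folklore] -/ theorem Fu_differentiable : Differentiable ℝ Fu := Fu_contDiff.differentiable (by simp)

/-- kit lemma (plumbing) [folklore] -/ theorem Fl_differentiable : Differentiable ℝ Fl := Fl_contDiff.differentiable (by simp)

/-- kit lemma (plumbing) [folklore] -/ theorem fderiv_Fu (x : E3) : fderiv ℝ Fu x = fderiv ℝ (F aW) (x + dvec) := fderiv_comp_add_right dvec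

/-- kit lemma (plumbing) [folklore] -/ theorem curl_Fu (x : E3) : curl Fu x = curl (F aW) (x + dvec) := by
  rw [curl_eq_curlCLM, fderiv_Fu, ← curl_eq_curlCLM]

/-- kit lemma (plumbing) [folklore] -/ theorem sI_Fu (x : E3) : sI Fu x = sI (F aW) (x + dvec) := by
  rw [sI, sI, curl_Fu, fderiv_Fu]

/-- kit lemma (plumbing) [folklore] -/ theorem sI_Fl (x : E3) : sI Fl x = sI Fu (mirrorZ x) := sI_conj_mirror Fu x

/-- kit lemma (plumbing) [folklore] -/ theorem Fu_eventuallyEq_zero {x : E3} (hx : x 2 < 3 / 2) : Fu =ᶠ[𝓝 x] fun _ => 0 := by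
  have hopen : IsOpen {z : E3 | z 2 < 3 / 2} := isOpen_lt (contDiff_coord 2).continuous continuous_const
  filter_upwards [hopen.mem_nhds hx] with z hz
  have h1 := normsq_add_dvec_ge z
  have hz' : z 2 < 3 / 2 := hz
  exact F_eq_zero (by nlinarith)

/-- kit lemma (plumbing) [folklore] -/ theorem Fl_eventuallyEq_zero {x : E3} (hx : -(3 / 2) < x 2) : Fl =ᶠ[𝓝 x] fun _ => 0 := by
  have hopen : IsOpen {z : E3 | -(3 / 2) < z 2} :=
    isOpen_lt continuous_const (contDiff_coord 2).continuous
  filter_upwards [hopen.mem_nhds hx] with z hz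
  have h1 := normsq_add_dvec_ge (mirrorZ z)
  rw [mirrorZ_apply_two] at h1
  have hz' : -(3 / 2) < z 2 := hz
  show mirrorZ (F aW (mirrorZ z + dvec)) = 0
  rw [F_eq_zero (by nlinarith), mirrorZ_zero]

/-- kit lemma (plumbing) [folklore] -/ theorem U_eventuallyEq_Fl {x : E3} (hx : x 2 < 3 / 2) : U =ᶠ[𝓝 x] Fl :=
  (Fu_eventuallyEq_zero hx).mono fun z hz => by show Fu z + Fl z = Fl z; rw [hz, zero_add]

/-- kit lemma (plumbing) [folklore] -/ theorem U_eventuallyEq_Fu {x : E3} (hx : -(3 / 2) < x 2) : U =ᶠ[𝓝 x] Fu :=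
  (Fl_eventuallyEq_zero hx).mono fun z hz => by show Fu z + Fl z = Fu z; rw [hz, add_zero]

/-- POINTWISE SPLITTING of the stretching integrand (the two blobs never see each other). -/
theorem sI_U (x : E3) : sI U x = sI Fu x + sI Fl x := by
  by_cases hx : x 2 < 3 / 2
  · rw [sI_congr_nhds (U_eventuallyEq_Fl hx), sI_congr_nhds (Fu_eventuallyEq_zero hx), sI_zero_fun,
      zero_add]
  · have hx' : -(3 / 2) < x 2 := by linarith [not_lt.1 hx]
    rw [sI_congr_nhds (U_eventuallyEq_Fu hx'), sI_congr_nhds (Fl_eventuallyEq_zero hx'), sI_zero_fun,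
      add_zero]

/-- kit lemma (plumbing) [folklore] -/ theorem Fu_eq_zero_of_norm {x : E3} (hx : 5 < ‖x‖) : Fu x = 0 := by
  have h1 : ‖x‖ ≤ ‖x + dvec‖ + ‖dvec‖ := by
    have h := norm_sub_le (x + dvec) dvec
    rwa [add_sub_cancel_right] at h
  rw [norm_dvec] at h1
  exact F_eq_zero_of_norm (by linarith)

/-- kit lemma (plumbing) [folklore] -/ theorem Fu_hasCompactSupport : HasCompactSupport Fu := by
  refine HasCompactSupport.intro (isCompact_closedBall (0 : E3) 5) fun x hx => Fu_eq_zero_of_norm ?_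
  simpa [mem_closedBall, dist_zero_right] using hx

/-- kit lemma (plumbing) [folklore] -/ theorem Fl_hasCompactSupport : HasCompactSupport Fl := by
  refine HasCompactSupport.intro (isCompact_closedBall (0 : E3) 5) fun x hx => ?_
  have h5 : 5 < ‖x‖ := by simpa [mem_closedBall, dist_zero_right] using hx
  show mirrorZ (Fu (mirrorZ x)) = 0
  rw [Fu_eq_zero_of_norm (by rwa [norm_mirrorZ]), mirrorZ_zero]

/-- kit lemma (plumbing) [folklore] -/ theorem U_hasCompactSupport : HasCompactSupport U := Fu_hasCompactSupport.add Fl_hasCompactSupport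

/-- **EXACT IDENTITY for the datum**: `stretchI U = 2 · stretchI (C + aW • w) = 2 (aW² Ew + stretchI C)`. -/
theorem stretchI_U : stretchI U = 2 * stretchI (F aW) := by
  have h1 : ∫ x, sI Fu x = stretchI (F aW) := by
    simp_rw [sI_Fu]
    rw [integral_add_right_eq_self (fun y => sI (F aW) y) dvec]
    rfl
  have h2 : ∫ x, sI Fl x = ∫ x, sI Fu x := by
    simp_rw [sI_Fl]
    exact Ri.measurePreserving.integral_comp Ri.toHomeomorph.measurableEmbedding (sI Fu)
  rw [stretchI_eq]
  simp_rw [sI_U]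
  rw [integral_add (integrable_sI Fu_contDiff Fu_hasCompactSupport)
    (integrable_sI Fl_contDiff Fl_hasCompactSupport), h2, h1]
  ring

/-- kit lemma (plumbing) [folklore] -/ theorem stretchI_U_pos : 0 < stretchI U := by
  rw [stretchI_U]; linarith [stretchI_F_aW_pos]

/-! ### `U` is an admissible datum -/

/-- kit lemma (plumbing) [folklore] -/ theorem divergence_Fu (x : E3) : VectorCalculus.divergence Fu x = 0 := by
  have h := divergence_F aW (x + dvec)
  simp only [VectorCalculus.divergence] at h ⊢
  rw [fderiv_Fu]; exact h

/-- kit lemma (plumbing) [folklore] -/ theorem divergence_Fl (x : E3) : VectorCalculus.divergence Fl x = 0 := by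
  have h := divergence_conj_linearIsometryEquiv Ri Fu x
  rw [divergence_Fu] at h
  exact h

/-- kit lemma (plumbing) [folklore] -/ theorem divergence_U (x : E3) : VectorCalculus.divergence U x = 0 := by
  have h1 := divergence_Fu x
  have h2 := divergence_Fl x
  simp only [VectorCalculus.divergence] at h1 h2 ⊢
  rw [show U = fun z => Fu z + Fl z from rfl, fderiv_fun_add (Fu_differentiable x) (Fl_differentiable x)]
  simp [h1, h2]

/-- kit lemma (plumbing) [folklore] -/ theorem curl_U_ne_zero : curl U ≠ 0 := by
  intro h
  have h3 : (x₀ - dvec) 2 = 3 := by simp [x₀, dvec]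
  have hp2 : -(3 / 2) < (x₀ - dvec) 2 := by rw [h3]; norm_num
  have h1 : curl U (x₀ - dvec) = curl (F aW) x₀ := by
    rw [curl_congr_nhds (U_eventuallyEq_Fu hp2), curl_Fu, sub_add_cancel]
  have hx₀ : ‖x₀‖ ^ 2 < 1 := by
    rw [normsq_eq]; simp [x₀]; norm_num
  rw [curl_F, curl_C_of_lt_one hx₀, zero_add, h] at h1
  exact smul_ne_zero aW_neg.ne curl_w_x₀_ne_zero h1.symm

/-- kit lemma (plumbing) [folklore] -/ theorem isOuroDatum_U : IsOuroDatum U :=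
  ⟨⟨U_contDiff, fun x => divergence_U x, fun n =>
    (HasRapidSpatialDecay.of_hasCompactSupport U_contDiff U_hasCompactSupport)
      |>.lintegral_enorm_iteratedFDeriv_sq_lt_top n⟩,
    hasCompactSupport_curl U_hasCompactSupport, curl_U_ne_zero⟩

/-! ### `U` has the printed geometry -/

/-- The azimuthal direction field of the clause «no swirl». -/
def eθ (x : E3) : E3 := WithLp.toLp 2 ![-x 1, x 0, 0]

/-- kit lemma (plumbing) [folklore] -/ theorem eθ_add_dvec (x : E3) : eθ (x + dvec) = eθ x := by
  ext i; fin_cases i <;> simp [eθ, dvec]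

/-- kit lemma (plumbing) [folklore] -/ theorem eθ_mirrorZ (x : E3) : eθ (mirrorZ x) = eθ x := by
  ext i; fin_cases i <;> simp [eθ]

/-- kit lemma (plumbing) [folklore] -/ theorem mirrorZ_eθ (x : E3) : mirrorZ (eθ x) = eθ x := by
  ext i; fin_cases i <;> simp [eθ, mirrorZ]

/-- kit lemma (plumbing) [folklore] -/ theorem inner_mirrorZ_left (u v : E3) : ⟪mirrorZ u, v⟫ = ⟪u, mirrorZ v⟫ := by
  rw [inner_eq3, inner_eq3]; simp

/-- kit lemma (plumbing) [folklore] -/ theorem inner_F_eθ (a : ℝ) (y : E3) : ⟪F a y, eθ y⟫ = 0 := by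
  show ⟪C y + a • w y, WithLp.toLp 2 ![-y 1, y 0, 0]⟫ = 0
  rw [inner_add_left, inner_smul_left, inner_C_etheta, inner_w_etheta]; simp

/-- kit lemma (plumbing) [folklore] -/ theorem inner_Fu_eθ (x : E3) : ⟪Fu x, eθ x⟫ = 0 := by
  rw [← eθ_add_dvec]; exact inner_F_eθ aW (x + dvec)

/-- kit lemma (plumbing) [folklore] -/ theorem inner_Fl_eθ (x : E3) : ⟪Fl x, eθ x⟫ = 0 := by
  show ⟪mirrorZ (Fu (mirrorZ x)), eθ x⟫ = 0
  rw [inner_mirrorZ_left, mirrorZ_eθ, ← eθ_mirrorZ]; exact inner_Fu_eθ (mirrorZ x)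

/-- Clause 2 (no swirl). -/
theorem inner_U_eθ (x : E3) : ⟪U x, WithLp.toLp 2 ![-x 1, x 0, 0]⟫ = 0 := by
  show ⟪Fu x + Fl x, eθ x⟫ = 0
  rw [inner_add_left, inner_Fu_eθ, inner_Fl_eθ, add_zero]

/-- Clause 1 (mirror symmetry). -/
theorem U_mirrorZ (x : E3) : U (mirrorZ x) = mirrorZ (U x) := by
  simp only [U, Fl, mirrorZ_mirrorZ, mirrorZ_add]; exact add_comm _ _

/-- kit lemma (plumbing) [folklore] -/ theorem curl_U_mirrorZ (x : E3) : curl U (mirrorZ x) = -mirrorZ (curl U x) := by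
  have hconj : (fun z => mirrorZ (U (mirrorZ z))) = U := by
    funext z; rw [U_mirrorZ, mirrorZ_mirrorZ]
  have h := curl_conj_mirror U (mirrorZ x)
  rw [hconj, mirrorZ_mirrorZ] at h
  exact h

/-- Clause 3 (no vorticity on the collision plane — in fact on the slab `|x₂| < 3/2`). -/
theorem curl_U_plane (x : E3) (hx : x 2 = 0) : curl U x = 0 := by
  have h1 : U =ᶠ[𝓝 x] fun _ => 0 :=
    (U_eventuallyEq_Fu (by rw [hx]; norm_num)).trans (Fu_eventuallyEq_zero (by rw [hx]; norm_num))
  rw [curl_congr_nhds h1]; exact curl_fun_zero x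

/-- The two axis points on the boundary sphere `‖y‖² = 2` of the cavity carry no vorticity
(closure argument: `curl F` is continuous and vanishes outside that sphere). -/
theorem curl_F_axis_boundary (a s : ℝ) (hs : s ^ 2 = 2) :
    curl (F a) (EuclideanSpace.single 2 s) = 0 := by
  have hcont : Continuous (curl (F a)) := continuous_curl ((F_contDiff a).of_le (mod_cast le_top))
  have hZ : IsClosed {y : E3 | curl (F a) y = 0} := isClosed_eq hcont continuous_const
  have hn : ‖(EuclideanSpace.single (2 : Fin 3) s : E3)‖ ^ 2 = 2 := by
    rw [normsq_eq]; simp [hs]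
  have hγc : Continuous fun t : ℝ => (1 + t) • (EuclideanSpace.single (2 : Fin 3) s : E3) :=
    (continuous_const.add continuous_id).smul continuous_const
  have ht : Tendsto (fun t : ℝ => (1 + t) • (EuclideanSpace.single (2 : Fin 3) s : E3)) (𝓝[>] 0)
      (𝓝 (EuclideanSpace.single 2 s)) := by
    have h0 := (hγc.tendsto 0).mono_left (nhdsWithin_le_nhds (s := Ioi (0 : ℝ)))
    simpa using h0
  have hev : ∀ᶠ t in 𝓝[>] (0 : ℝ),
      (1 + t) • (EuclideanSpace.single (2 : Fin 3) s : E3) ∈ {y : E3 | curl (F a) y = 0} := by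
    refine eventually_nhdsWithin_of_forall fun t ht => ?_
    have ht' : 0 < t := ht
    refine curl_F_eq_zero ?_
    rw [norm_smul, mul_pow, hn, Real.norm_eq_abs, sq_abs]
    nlinarith
  exact hZ.mem_of_tendsto ht hev

/-- kit lemma (plumbing) [folklore] -/ theorem axis_point_add_dvec (x : E3) :
    (WithLp.toLp 2 ![0, 0, x 2] : E3) + dvec = EuclideanSpace.single 2 (x 2 - 3) := by
  ext i; fin_cases i <;> simp [dvec]; ring

/-- kit lemma (plumbing) [folklore] -/ theorem F_axis_two (a ζ : ℝ) :
    F a (EuclideanSpace.single 2 ζ) 2 = hC (ζ ^ 2) * (-2 * (ζ + 2)) + a * (2 * G (ζ ^ 2)) := by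
  show (C _ + a • w _) 2 = _
  rw [PiLp.add_apply, PiLp.smul_apply, C_axis_two, w_axis_two, smul_eq_mul]

/-- The heart of clause 4: above the plane, wherever `U` carries vorticity, the axial velocity on the
axis at that height points DOWN (the shifted strain gives `−2 h (ζ+2) < 0`, the ring `2 aW G ≤ 0`). -/
theorem U_axis_two_neg {x : E3} (hx : 0 < x 2) (hne : curl U x ≠ 0) :
    (U (WithLp.toLp 2 ![0, 0, x 2])) 2 < 0 := by
  have hx' : -(3 / 2) < x 2 := by linarith
  rw [curl_congr_nhds (U_eventuallyEq_Fu hx'), curl_Fu] at hne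
  -- the blob-frame point `y = x + d` lies in the closed ball of radius √2 …
  have hA : ‖x + dvec‖ ^ 2 ≤ 2 := by
    by_contra h
    exact hne (curl_F_eq_zero (lt_of_not_ge h))
  -- … and strictly inside it along the axis direction
  have hle := normsq_add_dvec_ge x
  have hB : (x 2 - 3) ^ 2 < 2 := by
    by_contra h
    have h2 : 2 ≤ (x 2 - 3) ^ 2 := le_of_not_gt h
    have hn : ‖x + dvec‖ ^ 2 = (x + dvec) 0 ^ 2 + (x + dvec) 1 ^ 2 + (x + dvec) 2 ^ 2 :=
      normsq_eq (x + dvec)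
    rw [add_dvec_apply_two] at hn
    have h0sq : (x + dvec) 0 ^ 2 = 0 := by nlinarith [sq_nonneg ((x + dvec) 0), sq_nonneg ((x + dvec) 1)]
    have h1sq : (x + dvec) 1 ^ 2 = 0 := by nlinarith [sq_nonneg ((x + dvec) 0), sq_nonneg ((x + dvec) 1)]
    have h0 : (x + dvec) 0 = 0 := pow_eq_zero_iff (two_ne_zero) |>.1 h0sq
    have h1 : (x + dvec) 1 = 0 := pow_eq_zero_iff (two_ne_zero) |>.1 h1sq
    have hyeq : x + dvec = EuclideanSpace.single 2 (x 2 - 3) := by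
      ext i
      fin_cases i
      · simpa using h0
      · simpa using h1
      · simpa using add_dvec_apply_two x
    have hs : (x 2 - 3) ^ 2 = 2 := by linarith
    exact hne (by rw [hyeq]; exact curl_F_axis_boundary aW (x 2 - 3) hs)
  -- evaluate `U` at the axis point: only the upper blob is present there
  have hp2 : -(3 / 2) < (WithLp.toLp 2 ![0, 0, x 2] : E3) 2 := by
    simp; linarith
  have hU : U (WithLp.toLp 2 ![0, 0, x 2]) = F aW (EuclideanSpace.single 2 (x 2 - 3)) := by
    show Fu _ + Fl _ = _
    rw [(Fl_eventuallyEq_zero hp2).self_of_nhds, add_zero, Fu, axis_point_add_dvec]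
  rw [hU, F_axis_two]
  have hh : 0 < hC ((x 2 - 3) ^ 2) := hC_pos hB
  have hz : 0 < x 2 - 3 + 2 := by nlinarith [sq_nonneg (x 2 - 3 + 2)]
  have hG : 0 ≤ G ((x 2 - 3) ^ 2) := G_nonneg (sq_nonneg _)
  nlinarith [mul_pos hh hz, mul_nonneg hG (neg_nonneg.2 aW_neg.le)]

/-- Clause 4 (the blobs approach the plane). -/
theorem U_approach (x : E3) (hne : curl U x ≠ 0) : x 2 * (U (WithLp.toLp 2 ![0, 0, x 2])) 2 < 0 := by
  rcases lt_trichotomy (x 2) 0 with hlt | heq | hgt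
  · have hne' : curl U (mirrorZ x) ≠ 0 := by
      rw [curl_U_mirrorZ]
      intro h
      apply hne
      have h' := congrArg mirrorZ (neg_eq_zero.1 h)
      rwa [mirrorZ_mirrorZ, mirrorZ_zero] at h'
    have h := U_axis_two_neg (x := mirrorZ x) (by rw [mirrorZ_apply_two]; linarith) hne'
    rw [mirrorZ_apply_two] at h
    have hp : (WithLp.toLp 2 ![0, 0, -x 2] : E3) = mirrorZ (WithLp.toLp 2 ![0, 0, x 2]) := by
      ext i; fin_cases i <;> simp
    rw [hp, U_mirrorZ, mirrorZ_apply_two] at h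
    exact mul_neg_of_neg_of_pos hlt (by linarith)
  · exact absurd (curl_U_plane x heq) hne
  · exact mul_neg_of_pos_of_neg hgt (U_axis_two_neg hgt hne)

/-- kit lemma (plumbing) [folklore] -/ theorem isOuroGeometry_U : IsOuroGeometry U := ⟨U_mirrorZ, inner_U_eθ, curl_U_plane, U_approach⟩

/-- kit lemma (plumbing) [folklore] -/ theorem isAlignedDatumI_U : IsAlignedDatumI U := stretchI_U_pos

/-- **NON-VACUITY OF THE TOKEN'S CLASS (C137 `LucardoOlivaes2026`, ADJUDICATED #120, REF F6):**
the printed initial-data class of (6) §4.1 — admissible datum, the four geometric clauses of §3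
p.2 l.12–26, and positive total stretching `0 < ∫ ωᵀ S ω` — is inhabited by an explicit compactly
supported field. [cite LucardoOlivaes2026] -/
theorem step3GI_Datum_holds : Step3GI_Datum := ⟨U, isOuroDatum_U, isOuroGeometry_U, isAlignedDatumI_U⟩

example : Literature.Claims.NS.LucardoOlivaes2026.Step3GI_Datum := step3GI_Datum_holds

end Summit.NavierStokesRegularity.NavierStokesRegularity.Theorems.LucardoOlivaes2026GI

end
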